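import Summits.CriticalPhenomena.PercolationContinuityZ3.Theorems.PercTorusSliceFillingNoCriticalTorusGiantNecessity
import HarnessLib

/-!
# `giantDensity_le_theta_of_localCountChebyshev` (F1b) of line `registered`
# (crux `NoCriticalTorusGiant`, stmt-CriticalPhenomena-5407): torus giants have density `≤ θ(p)`

Registered stub `giantDensity_le_theta_of_localCountChebyshev` of the lead's skeleton
`Cruxes/NoCriticalTorusGiant/Lines/birth.lean` (reshape c3, composition F1b of the side stub
F1a `stub_localCountChebyshev`, which is taken here as the ANTECEDENT of the arrow).

Statement: assume the Chebyshev bound F1a — for Bernoulli bond percolation on the discrete torus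
`T_n = (ℤ/nℤ)³` (`torusGraph 3 n`) at any edge density `p`, every `m, n` with `4m + 4 ≤ n` and
every `η > 0`,

  `P_{T_n,p}( #{x : |C(x)| ≥ m+1} ≥ (θ_{m+1} + η) n³ ) ≤ (4m+3)³ / (η² n³)`,

where `θ_{m+1} = P_{ℤ³,p}(|C(0)| ≥ m+1)` (`clusterSizeGe`).  Then for every `p` and every `η > 0`,

  `P_{T_n,p}( ∃ x, |C(x)| ≥ (θ(p) + η) n³ ) → 0`  as `n → ∞`,

with `θ(p) = theta (zdGraph 3) 0 p`: open clusters of the torus have density at most `θ(p)`.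

Proof.  Fix `p`, `η > 0` and `δ > 0`.  Since `θ_{M+1} ↓ θ(p)` (`tendsto_real_clusterSizeGe`),
pick `m` with `θ_{m+1} < θ(p) + η/2`.  For `n` large (`4m + 4 ≤ n`, `m + 1 ≤ η n³`, and the
Chebyshev constant `(4m+3)³ / ((η/2)² n³) < δ`): on the event `∃ x, |C(x)| ≥ (θ + η) n³`, every
`y ∈ C(x)` has `C(y) = C(x)`, hence `|C(y)| ≥ (θ + η) n³ ≥ η n³ ≥ m + 1` (`θ ≥ 0`), so
`#{y : |C(y)| ≥ m+1} ≥ |C(x)| ≥ (θ + η) n³ ≥ (θ_{m+1} + η/2) n³`; the hypothesis with `η/2`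
bounds the probability by `(4m+3)³ / ((η/2)² n³) < δ`.  Mathlib + the tree only.
-/

noncomputable section

namespace Summit.CriticalPhenomena.PercolationContinuityZ3.Theorems.PercTorusSliceFillingNoCriticalTorusGiant

open MeasureTheory ProbabilityTheory Filter Topology
open Literature.Probability.Percolation Literature.Probability.LatticeModels

namespace F1b

/-- **Pointwise inclusion.** If `m + 1 ≤ a` and some open cluster `C(x)` of the configuration
`ω` has `a ≤ |C(x)|` (real-valued size), then at least `a` vertices `y` have `|C(y)| ≥ m + 1`:
every `y ∈ C(x)` has `C(y) = C(x)` (reachability is an equivalence), so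
`C(x) ⊆ {y | m + 1 ≤ |C(y)|}` and `Set.ncard` is monotone on the finite vertex type. -/
theorem le_ncard_setOf_succ_le_ncard {V : Type*} [Finite V] (ω : BondConfig V) {m : ℕ} {a : ℝ}
    (hma : (m : ℝ) + 1 ≤ a) {x : V} (hx : a ≤ ((openCluster ω x).ncard : ℝ)) :
    a ≤ (({y : V | m + 1 ≤ (openCluster ω y).ncard}.ncard : ℕ) : ℝ) := by
  have hmx : m + 1 ≤ (openCluster ω x).ncard := by
    have h : ((m + 1 : ℕ) : ℝ) ≤ ((openCluster ω x).ncard : ℝ) := by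
      push_cast
      exact hma.trans hx
    exact_mod_cast h
  have hCsub : openCluster ω x ⊆ {y : V | m + 1 ≤ (openCluster ω y).ncard} := by
    intro y hy
    have hC : openCluster ω y = openCluster ω x := by
      ext z
      simp only [openCluster, Set.mem_setOf_eq] at hy ⊢
      exact ⟨fun h => hy.trans h, fun h => hy.symm.trans h⟩
    show m + 1 ≤ (openCluster ω y).ncard
    rw [hC]
    exact hmx
  have hcard : (openCluster ω x).ncard ≤ {y : V | m + 1 ≤ (openCluster ω y).ncard}.ncard :=
    Set.ncard_le_ncard hCsub (Set.toFinite _)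
  exact hx.trans (by exact_mod_cast hcard)

/-- The Chebyshev constant `(4m+3)³ / (c n³)` tends to `0` as `n → ∞` for `c > 0`. -/
theorem tendsto_chebyshevConst (m : ℕ) {c : ℝ} (hc : 0 < c) :
    Tendsto (fun n : ℕ => (4 * (m : ℝ) + 3) ^ 3 / (c * (n : ℝ) ^ 3)) atTop (𝓝 0) := by
  have hden : Tendsto (fun n : ℕ => c * (n : ℝ) ^ 3) atTop atTop :=
    ((tendsto_pow_atTop (by norm_num : (3 : ℕ) ≠ 0)).comp
      tendsto_natCast_atTop_atTop).const_mul_atTop hc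
  exact tendsto_const_nhds.div_atTop hden

end F1b

/-- **F1b — torus giants have density at most `θ(p)`.**  Assuming the Chebyshev bound F1a
(`stub_localCountChebyshev`: for `4m + 4 ≤ n` and `η > 0`,
`P_{T_n,p}(#{x : |C(x)| ≥ m+1} ≥ (θ_{m+1} + η) n³) ≤ (4m+3)³/(η² n³)` with
`θ_{m+1} = P_{ℤ³,p}(|C(0)| ≥ m+1)`), for every edge density `p` and every `η > 0`,
`P_{T_n,p}(∃ x, |C(x)| ≥ (θ(p) + η) n³) → 0`.  Pick `m` with `θ_{m+1} < θ(p) + η/2`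
(`tendsto_real_clusterSizeGe`); on the giant event at least `|C(x)| ≥ (θ_{m+1} + η/2) n³`
vertices lie in clusters of size `≥ m + 1` (`F1b.le_ncard_setOf_succ_le_ncard`), and the
hypothesis with `η/2` gives the bound `(4m+3)³/((η/2)² n³) → 0` (`F1b.tendsto_chebyshevConst`). -/
theorem giantDensity_le_theta_of_localCountChebyshev : (∀ (p : unitInterval) (n m : ℕ) (η : ℝ), 0 < η → 4 * m + 4 ≤ n → (bondPercolation (torusGraph 3 n) p).real {ω | ((bondPercolation (zdGraph 3) p).real (clusterSizeGe (0 : Site 3) (m + 1)) + η) * (n : ℝ) ^ 3 ≤ (({x : TorusSite 3 n | m + 1 ≤ (openCluster ω x).ncard}.ncard : ℕ) : ℝ)} ≤ (4 * (m : ℝ) + 3) ^ 3 / (η ^ 2 * (n : ℝ) ^ 3)) → ∀ (p : unitInterval) (η : ℝ), 0 < η → Tendsto (fun n : ℕ => (bondPercolation (torusGraph 3 n) p).real {ω | ∃ x : TorusSite 3 n, (theta (zdGraph 3) (0 : Site 3) p + η) * (n : ℝ) ^ 3 ≤ ((openCluster ω x).ncard : ℝ)}) atTop (nhds 0) := by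
  intro hF p η hη
  have hη2 : 0 < η / 2 := half_pos hη
  have hθ0 : 0 ≤ theta (zdGraph 3) (0 : Site 3) p := measureReal_nonneg
  -- `θ_{M+1} → θ(p)`
  have hθM : Tendsto (fun M : ℕ => (bondPercolation (zdGraph 3) p).real
      (clusterSizeGe (0 : Site 3) (M + 1))) atTop (𝓝 (theta (zdGraph 3) (0 : Site 3) p)) :=
    (tendsto_real_clusterSizeGe (zdGraph 3) (0 : Site 3) p).comp (tendsto_add_atTop_nat 1)
  rw [tendsto_order]
  refine ⟨fun a ha => Eventually.of_forall fun n => ha.trans_le measureReal_nonneg,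
    fun δ hδ => ?_⟩
  -- pick `m` with `θ_{m+1} < θ + η/2`
  obtain ⟨m, hm⟩ := ((tendsto_order.1 hθM).2 (theta (zdGraph 3) (0 : Site 3) p + η / 2)
    (by linarith)).exists
  have hn1 : ∀ᶠ n : ℕ in atTop, 4 * m + 4 ≤ n := eventually_ge_atTop _
  have hn2 : ∀ᶠ n : ℕ in atTop, (m : ℝ) + 1 ≤ η * (n : ℝ) ^ 3 := by
    have ht : Tendsto (fun n : ℕ => η * (n : ℝ) ^ 3) atTop atTop :=
      ((tendsto_pow_atTop (by norm_num : (3 : ℕ) ≠ 0)).comp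
        tendsto_natCast_atTop_atTop).const_mul_atTop hη
    exact ht.eventually_ge_atTop _
  have hn3 : ∀ᶠ n : ℕ in atTop, (4 * (m : ℝ) + 3) ^ 3 / ((η / 2) ^ 2 * (n : ℝ) ^ 3) < δ :=
    (tendsto_order.1 (F1b.tendsto_chebyshevConst m (pow_pos hη2 2))).2 δ hδ
  filter_upwards [hn1, hn2, hn3] with n h1 h2 h3
  haveI : NeZero n := ⟨by omega⟩
  refine lt_of_le_of_lt ?_ h3
  refine le_trans (measureReal_mono ?_ (measure_ne_top _ _)) (hF p n m (η / 2) hη2 h1)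
  rintro ω ⟨x, hx⟩
  have hma : (m : ℝ) + 1 ≤ (theta (zdGraph 3) (0 : Site 3) p + η) * (n : ℝ) ^ 3 :=
    h2.trans (mul_le_mul_of_nonneg_right (by linarith) (by positivity))
  have hle : ((bondPercolation (zdGraph 3) p).real (clusterSizeGe (0 : Site 3) (m + 1)) + η / 2) *
      (n : ℝ) ^ 3 ≤ (theta (zdGraph 3) (0 : Site 3) p + η) * (n : ℝ) ^ 3 :=
    mul_le_mul_of_nonneg_right (by linarith) (by positivity)
  exact hle.trans (F1b.le_ncard_setOf_succ_le_ncard ω hma hx)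

end Summit.CriticalPhenomena.PercolationContinuityZ3.Theorems.PercTorusSliceFillingNoCriticalTorusGiant
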